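import Literature.NumberTheory.GaloisRepresentations.InertiaRootsOfUnity
import Mathlib.LinearAlgebra.FreeModule.Finite.Matrix
import Mathlib.FieldTheory.PrimitiveElement
import Mathlib.FieldTheory.SeparableDegree
import HarnessLib

/-!
# Unramifiedness of `F(μ_N)/F` and the surjectivity of the Kummer characters `θ_d : I_F → μ_d` (trunk GalRep; items C15, C16)

Let `F` be a non-archimedean local field, `‖·‖ = algNorm F` the absolute value of
`F̄ = AlgebraicClosure F`, `S ⊃ 𝔓` its valuation ring and maximal ideal (`absIntegers 𝒪[F] F`,
`absMaximalIdeal F`), `𝓀[F] ↪ S ⧸ 𝔓` the residue fields, `I_F = absInertia F` the inertia group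
and `ϖ` a uniformiser of `𝒪[F]` (file `InertiaRootsOfUnity`).  This file proves the arithmetic
input of Serre's description of the tame inertia (Serre, Invent. Math. 15 (1972), §1.3):

* `Literature.NumberTheory.GaloisRepresentations.IsNonarchimedeanLocalField.exists_mem_absInertia_smul_eq_mul` — **for every `d ≥ 1`,
  every root `z ∈ F̄` of `z ^ d = ϖ` and every `ζ` with `ζ ^ d = 1` there is `σ ∈ I_F` with
  `σ z = ζ z`**; i.e. the Kummer character `θ_d : I_F → μ_d`, `s(x^{1/d}) = θ_d(s) x^{1/d}`, is
  surjective (Serre 1972, §1.3: "l'application `θ_d : Gal(K_d/K_nr) → μ_d` … est un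
  isomorphisme"; `K_d = K_nr(x^{1/d})`, and `I = Gal(K_s/K_nr)` maps onto `Gal(K_d/K_nr)`).

The proof is Serre's: `K_d/K_nr` is totally ramified of degree `d` because `x` is still a
uniformiser of the *unramified* extension `K_nr = K(μ_{p'})`; concretely
(`minpoly_maxUnramified_eq`) the minimal polynomial of `z` over
`F_nr = maxUnramified F = F(μ_{p'})` is `X ^ d - ϖ`, because the powers `z ^ i`, `i < d`, are
`F_nr`-independent, the non-zero terms `m_i z ^ i` of a relation having pairwise distinct norms
`‖ϖ‖ ^ (n_i + i/d)` (`linearIndependent_pow_of_pow_eq_uniformizer`,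
`eq_zero_of_sum_eq_zero_of_algNorm_injOn`); so `ζ z` is an `Aut(F̄/F_nr)`-conjugate of `z`
(Mathlib `minpoly.exists_algEquiv_of_root'`), and `Aut(F̄/F_nr) = I_F`
(`mem_absInertia_iff_forall_mem_maxUnramified`, from `mem_absInertia_iff_smul_rootsOfUnity`).
The one genuinely arithmetic input is

* `Literature.NumberTheory.GaloisRepresentations.IsNonarchimedeanLocalField.exists_algNorm_eq_zpow_of_mem_adjoin_rootOfUnity`,
  `…_of_mem_maxUnramified` — **`F(ζ)/F` is unramified for a root of unity `ζ` of order `N`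
  prime to `p`**: every non-zero `x ∈ F⟮ζ⟯` (resp. `x ∈ F_nr`) has `‖x‖ ∈ ‖ϖ‖ ^ ℤ` (Serre,
  *Local Fields*, Ch. IV §4, Prop. 16: "The field `K_n` is an unramified extension of `K`", and
  Cor. 2: `K_nr = K(μ_{p'})`),

proved here *without* Hensel's lemma by counting: with `E = F⟮ζ⟯`, `n = [E : F]`,
`k_E = residueSubalgebra E ⊆ S ⧸ 𝔓` the residue algebra of `E` and `f = dim_{𝓀[F]} k_E`,
(i) `f ≤ n` and more precisely a `𝓀[F]`-independent family of residues lifts to an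
`F`-independent family (`linearIndependent_of_residue`, the **lifting lemma**
`algNorm_sum_smul_eq_sup`: `‖∑ α_i b_i‖ = max ‖α_i‖`); (ii) `n ≤ f`, since the `n` embeddings
`E → F̄` (Mathlib `AlgHom.card`, `E/F` separable) induce pairwise distinct `𝓀[F]`-algebra maps
`k_E → S ⧸ 𝔓` (`residueAlgHom`; distinct because an embedding is determined by the image of
`ζ`, and roots of unity of order prime to `p` are distinct modulo `𝔓`), of which there are at most
`f` (Dedekind independence of characters, Mathlib `card_algHom_le_finrank`); (iii) if some
`x ∈ E` had `‖x‖ ∉ ‖ϖ‖ ^ ℤ`, the family `(b_j, x b_j)` with `b_j` lifting a basis of `k_E` would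
be `F`-independent (`linearIndependent_sum_of_residue_of_algNorm`), giving `2f ≤ n ≤ f`,
absurd.  This is the inequality `e f ≤ n` together with `e = 1 ⇔` unramified of Serre, *Local
Fields*, Ch. I §4–§5 / Ch. III §5, in the minimal form needed.

## Main definitions

* `residueSubalgebra E : Subalgebra 𝓀[F] (S ⧸ 𝔓)` — the residue algebra `k_E` of an intermediate
  field `E` of `F̄/F` (residues of its elements of norm `≤ 1`); finite-dimensional of dimension
  `≤ [E : F]` and `≥ 1` (`finite_residueSubalgebra`, `finrank_residueSubalgebra_pos`).
* `residueAlgHom φ : k_E →ₐ[𝓀[F]] S ⧸ 𝔓` — the map induced by an embedding `φ : E →ₐ[F] F̄`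
  (`residueAlgHom_apply : residue y ↦ residue (φ y)`; well defined because embeddings are
  isometries, `algNorm_algHom_apply`).
* `primeToPRootsOfUnity F`, `maxUnramified F = F(μ_{p'})` (Serre's `K_nr`, by *Local Fields*
  IV §4 Cor. 2; here a definition, its unramifiedness being the theorem above).

## Mathlib search

Mathlib has `AlgHom.card` (number of embeddings of a finite separable extension into an
algebraically closed field), `card_algHom_le_finrank` (Dedekind's independence of characters),
`rank_le`, `Module.rank_lt_aleph0_iff`, `minpoly.exists_algEquiv_of_root'`,
`Normal.tower_top_of_normal`, `IntermediateField.exists_finset_of_mem_adjoin`,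
`IsPrimitiveRoot.eq_pow_of_pow_eq_one`, `Polynomial.eq_of_monic_of_dvd_of_natDegree_le`.  Its
unramifiedness notions are `Ideal.ramificationIdx`/`Ideal.inertiaDeg` for Dedekind extensions and
the commutative-algebra predicates `Algebra.FormallyUnramified`, `Algebra.IsUnramifiedAt`
(`Mathlib/RingTheory/Unramified`); none is set up for the valuation ring of `F̄` (not noetherian),
and there is no maximal unramified extension of a local field and no Kummer theory of local fields
(grep `unramified` in `Mathlib/NumberTheory/LocalField`, `MaximalUnramified`: no hits).  The
value-group formulation `‖x‖ ∈ ‖ϖ‖ ^ ℤ` used here needs none of them.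
Nothing here duplicates a Mathlib declaration or the tree (`lean search residueSubalgebra`,
`maxUnramified`, `exists_mem_absInertia`: no hits).

## Design choices

* Everything is expressed with elements of `F̄` and the total residue map `residue F`
  (`InertiaRootsOfUnity`), intermediate fields being `IntermediateField F (AlgebraicClosure F)`;
  this is the form in which `absUpperInertia`/`absInertia` and the Kummer roots of item C15 are
  given.  `residueAlgHom` is built from the function `residueLift` (a choice of lifts) and its
  characterising lemma `residueLift_eq`, then packaged as a ring and algebra homomorphism.
* `exists_mem_absInertia_smul_eq_mul` needs no hypothesis "`d` prime to `p`": `X ^ d - ϖ` is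
  irreducible over `F_nr` for every `d ≥ 1` (of course `μ_d` is smaller when `p ∣ d`).
* Two instances on the tree's own `residueSubalgebra E` (`Module.IsTorsionFree`, `Module.Free`
  over the field `𝓀[F]`, both by Mathlib's generic instances) are declared to keep instance
  search fast; they duplicate nothing.

## References

* [SerreInventiones1972] J.-P. Serre, *Propriétés galoisiennes des points d'ordre fini des courbes
  elliptiques*, Invent. Math. 15 (1972), §1.2 (`K_nr`, `I = Gal(K_s/K_nr)`), §1.3 ("Soit `x` une
  uniformisante de `K_nr`, et soit `K_d = K_nr(x^{1/d})`. L'extension `K_d/K_nr` est totalement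
  ramifiée, modérée, et de degré `d` … `θ_d : Gal(K_d/K_nr) → μ_d` … est un isomorphisme. De
  plus, `K_d` et `θ_d` ne dépendent pas du choix de `x`"), Prop. 1–2.
* [SerreLocalFields1979] J.-P. Serre, *Local Fields*, GTM 67, Springer 1979, Ch. I §4–§5 and
  Ch. III §5 (`e f = n`, unramified extensions), Ch. IV §4, Prop. 16 and Cor. 1–2 (`K(μ_n)/K`
  unramified for `n` prime to `p`; `K_nr = K(μ_{p'})`).
* [NeukirchANT1999] J. Neukirch, *Algebraic Number Theory*, Ch. II (4.8), (6.8), (7.5)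
  (unramified and tamely ramified extensions of henselian fields).
-/

noncomputable section

open ValuativeRel Field
open scoped Pointwise

namespace Literature.NumberTheory.GaloisRepresentations
namespace IsNonarchimedeanLocalField

open scoped IntermediateField

variable {F : Type*} [Field F] [ValuativeRel F] [TopologicalSpace F] [IsNonarchimedeanLocalField F]

/-! ### Embeddings of subextensions preserve the norm -/

/-- **Embeddings are isometries**: an `F`-algebra homomorphism `φ : E → F̄` of an intermediate
field `E` of `F̄/F` extends to an `F`-automorphism of `F̄` (Mathlib `AlgHom.liftNormal`), hence
preserves `algNorm`.  Ref: Serre, *Local Fields*, Ch. II §2, Cor. 3 to Prop. 3 (conjugate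
elements have the same valuation). [cite: SerreLocalFields1979, Ch. II §2 Cor. 3 to Prop. 3] -/
theorem algNorm_algHom_apply (E : IntermediateField F (AlgebraicClosure F))
    (φ : E →ₐ[F] AlgebraicClosure F) (y : E) : algNorm F (φ y) = algNorm F (y : AlgebraicClosure F) := by
  letI := nontriviallyNormedField F
  set ψ : AlgebraicClosure F →ₐ[F] AlgebraicClosure F := φ.liftNormal (AlgebraicClosure F) with hψ
  have hψy : ψ y = φ y := by
    rw [hψ]
    exact φ.liftNormal_commutes (AlgebraicClosure F) y
  set σ : AlgebraicClosure F ≃ₐ[F] AlgebraicClosure F :=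
    AlgEquiv.ofBijective ψ (Algebra.IsAlgebraic.algHom_bijective ψ)
  have : σ y = φ y := hψy
  rw [← this]
  exact (spectralNorm_eq_of_equiv σ (y : AlgebraicClosure F)).symm

/-- An embedding `φ : E → F̄` preserves congruences modulo `𝔓` between elements of `E` of norm
`≤ 1`. [folklore] -/
theorem residue_algHom_eq_of_residue_eq (E : IntermediateField F (AlgebraicClosure F))
    (φ : E →ₐ[F] AlgebraicClosure F) {x y : E} (hx : algNorm F (x : AlgebraicClosure F) ≤ 1)
    (hy : algNorm F (y : AlgebraicClosure F) ≤ 1) (h : residue F (x : AlgebraicClosure F) = residue F y) :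
    residue F (φ x) = residue F (φ y) := by
  rw [residue_eq_residue_iff (by rw [algNorm_algHom_apply]; exact hx)
    (by rw [algNorm_algHom_apply]; exact hy), ← map_sub, algNorm_algHom_apply]
  exact (residue_eq_residue_iff hx hy).mp h

/-! ### The lifting lemma -/

/-- **Lifting lemma**: if `b i ∈ F̄` have norm `≤ 1` and `𝓀[F]`-linearly independent residues,
then for coefficients `α i ∈ F` with `‖α i‖ ≤ ‖α i₀‖`, `α i₀ ≠ 0`, one has
`‖∑ α i b i‖ = ‖α i₀‖` (`= max ‖α i‖`): after dividing by `α i₀` the sum has norm `≤ 1` and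
non-zero residue `∑ ᾱ i • residue (b i)` (the `i₀`-th coefficient is `1`).
Ref: Serre, *Local Fields*, Ch. I §4, proof of Prop. 10 / Ch. II §2 (lifting a residue basis);
Neukirch, *ANT*, Ch. II, proof of (6.8). [cite: SerreLocalFields1979, Ch. II §2 Prop. 3] -/
theorem algNorm_sum_smul_eq_sup {ι : Type*} [Fintype ι] (b : ι → AlgebraicClosure F)
    (hb1 : ∀ i, algNorm F (b i) ≤ 1)
    (hind : LinearIndependent 𝓀[F] (fun i => residue F (b i)))
    (α : ι → F) {i₀ : ι} (hi₀ : ∀ i, algNorm F (algebraMap F _ (α i)) ≤ algNorm F (algebraMap F _ (α i₀)))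
    (hα : α i₀ ≠ 0) :
    algNorm F (∑ i, algebraMap F (AlgebraicClosure F) (α i) * b i) =
      algNorm F (algebraMap F (AlgebraicClosure F) (α i₀)) := by
  -- normalise: `β i = α i / α i₀ ∈ 𝒪[F]`, `β i₀ = 1`
  have hA : 0 < algNorm F (algebraMap F (AlgebraicClosure F) (α i₀)) :=
    algNorm_pos_iff.mpr ((map_ne_zero _).mpr hα)
  have hβ : ∀ i, α i / α i₀ ∈ 𝒪[F] := fun i => by
    rw [← algNorm_algebraMap_le_one_iff, map_div₀, algNorm_div, div_le_one hA]
    exact hi₀ i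
  set y := ∑ i, algebraMap F (AlgebraicClosure F) (α i / α i₀) * b i with hy
  have hterm : ∀ i, algNorm F (algebraMap F (AlgebraicClosure F) (α i / α i₀) * b i) ≤ 1 := fun i => by
    rw [algNorm_mul]
    exact mul_le_one₀ (algNorm_algebraMap_le_one_iff.mpr (hβ i)) (algNorm_nonneg _) (hb1 i)
  have hy1 : algNorm F y ≤ 1 := algNorm_sum_le _ _ zero_le_one (fun i _ => hterm i)
  -- residue of `y` is `∑ β̄ i • residue (b i) ≠ 0`
  have hres : residue F y = ∑ i, IsLocalRing.residue 𝒪[F] ⟨_, hβ i⟩ • residue F (b i) := by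
    rw [hy, residue_sum _ _ (fun i _ => hterm i)]
    refine Finset.sum_congr rfl fun i _ => ?_
    rw [residue_mul (algNorm_algebraMap_le_one_iff.mpr (hβ i)) (hb1 i), residue_algebraMap_field (hβ i),
      Algebra.smul_def]
  have hres0 : residue F y ≠ 0 := by
    rw [hres]
    intro h0
    have := (Fintype.linearIndependent_iff.mp hind) _ h0 i₀
    rw [IsLocalRing.residue_eq_zero_iff] at this
    apply (IsLocalRing.mem_maximalIdeal _).mp this |> fun h => h ?_
    -- `β i₀ = 1` is a unit
    have h1 : (⟨α i₀ / α i₀, hβ i₀⟩ : 𝒪[F]) = 1 := Subtype.ext (div_self hα)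
    rw [h1]; exact isUnit_one
  have hy' : algNorm F y = 1 := by
    by_contra hne
    exact hres0 ((residue_eq_zero_iff hy1).mpr (lt_of_le_of_ne hy1 hne))
  -- `∑ α i b i = α i₀ * y`
  have hsum : ∑ i, algebraMap F (AlgebraicClosure F) (α i) * b i =
      algebraMap F (AlgebraicClosure F) (α i₀) * y := by
    rw [hy, Finset.mul_sum]
    refine Finset.sum_congr rfl fun i _ => ?_
    rw [← mul_assoc, ← map_mul, mul_div_cancel₀ _ hα]
  rw [hsum, algNorm_mul, hy', mul_one]


/-- **Lifted residue-independent families are `F`-linearly independent** (`f ≤ n`): if the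
residues of `b i` (`‖b i‖ ≤ 1`) are `𝓀[F]`-independent then the `b i` are `F`-independent.
Ref: Serre, *Local Fields*, Ch. II §2; Neukirch, *ANT*, Ch. II (6.8). [folklore] -/
theorem linearIndependent_of_residue {ι : Type*} [Fintype ι] (b : ι → AlgebraicClosure F)
    (hb1 : ∀ i, algNorm F (b i) ≤ 1)
    (hind : LinearIndependent 𝓀[F] (fun i => residue F (b i))) :
    LinearIndependent F b := by
  rw [Fintype.linearIndependent_iff]
  intro α hα
  by_contra hne
  push Not at hne
  -- a coefficient of maximal norm
  obtain ⟨i₀, -, hi₀⟩ := Finset.exists_max_image Finset.univ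
    (fun i => algNorm F (algebraMap F (AlgebraicClosure F) (α i))) ⟨hne.choose, Finset.mem_univ _⟩
  have hα0 : α i₀ ≠ 0 := by
    intro h0
    obtain ⟨j, hj⟩ := hne
    have := hi₀ j (Finset.mem_univ j)
    rw [h0, map_zero, algNorm_zero] at this
    exact hj ((map_eq_zero _).mp (algNorm_eq_zero_iff.mp (le_antisymm this (algNorm_nonneg _))))
  have h := algNorm_sum_smul_eq_sup b hb1 hind α (fun i => hi₀ i (Finset.mem_univ i)) hα0
  simp only [Algebra.smul_def] at hα
  rw [hα, algNorm_zero, eq_comm, algNorm_eq_zero_iff, map_eq_zero] at h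
  exact hα0 h

/-- The norm of a non-trivial `F`-combination of a lifted residue-independent family lies in
the value group `‖ϖ‖ ^ ℤ` of `F`. [folklore] -/
theorem exists_algNorm_sum_eq_zpow {ι : Type*} [Fintype ι] (b : ι → AlgebraicClosure F)
    (hb1 : ∀ i, algNorm F (b i) ≤ 1)
    (hind : LinearIndependent 𝓀[F] (fun i => residue F (b i))) {ϖ : 𝒪[F]} (hϖ : Irreducible ϖ)
    (α : ι → F) (hα : α ≠ 0) :
    ∃ n : ℤ, algNorm F (∑ i, algebraMap F (AlgebraicClosure F) (α i) * b i) =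
      algNorm F (algebraMap 𝒪[F] (AlgebraicClosure F) ϖ) ^ n := by
  have hne : ∃ j, α j ≠ 0 := by
    by_contra h; push Not at h; exact hα (funext h)
  obtain ⟨i₀, -, hi₀⟩ := Finset.exists_max_image Finset.univ
    (fun i => algNorm F (algebraMap F (AlgebraicClosure F) (α i))) ⟨hne.choose, Finset.mem_univ _⟩
  have hα0 : α i₀ ≠ 0 := by
    intro h0
    obtain ⟨j, hj⟩ := hne
    have := hi₀ j (Finset.mem_univ j)
    rw [h0, map_zero, algNorm_zero] at this
    exact hj ((map_eq_zero _).mp (algNorm_eq_zero_iff.mp (le_antisymm this (algNorm_nonneg _))))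
  rw [algNorm_sum_smul_eq_sup b hb1 hind α (fun i => hi₀ i (Finset.mem_univ i)) hα0]
  exact exists_algNorm_algebraMap_eq_zpow hϖ hα0

/-- **`e f ≤ n` (the case `e ≥ 2` used here)**: a lifted residue-independent family `b` and its
multiples `x b` by an element `x` whose norm lies outside the value group `‖ϖ‖ ^ ℤ` of `F` are
jointly `F`-linearly independent (the norms of `∑ α_i b_i` and of `x ∑ γ_i b_i` lie in `‖ϖ‖ ^ ℤ`
and `‖x‖ ‖ϖ‖ ^ ℤ` respectively, which are disjoint).
Ref: Serre, *Local Fields*, Ch. I §4–§5 (`e f ≤ n`); Neukirch, *ANT*, Ch. II (6.8). [folklore] -/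
theorem linearIndependent_sum_of_residue_of_algNorm {ι : Type*} [Fintype ι] (b : ι → AlgebraicClosure F)
    (hb1 : ∀ i, algNorm F (b i) ≤ 1)
    (hind : LinearIndependent 𝓀[F] (fun i => residue F (b i))) {ϖ : 𝒪[F]} (hϖ : Irreducible ϖ)
    {x : AlgebraicClosure F} (hx0 : x ≠ 0)
    (hx : ∀ n : ℤ, algNorm F x ≠ algNorm F (algebraMap 𝒪[F] (AlgebraicClosure F) ϖ) ^ n) :
    LinearIndependent F (Sum.elim b (fun i => x * b i)) := by
  rw [Fintype.linearIndependent_iff]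
  intro g hg
  simp only [Fintype.sum_sum_type, Sum.elim_inl, Sum.elim_inr, Algebra.smul_def] at hg
  set α : ι → F := fun i => g (Sum.inl i) with hαdef
  set γ : ι → F := fun i => g (Sum.inr i) with hγdef
  have hP : ∑ i, algebraMap F (AlgebraicClosure F) (α i) * b i =
      -(x * ∑ i, algebraMap F (AlgebraicClosure F) (γ i) * b i) := by
    rw [eq_neg_iff_add_eq_zero, Finset.mul_sum]
    simpa only [hαdef, hγdef, mul_left_comm x] using hg
  have hc0 := algNorm_uniformizer_pos hϖ
  -- `γ = 0`
  have hγ : γ = 0 := by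
    by_contra hγ
    obtain ⟨k₁, hk₁⟩ := exists_algNorm_sum_eq_zpow b hb1 hind hϖ γ hγ
    by_cases hα : α = 0
    · have h0 : ∑ i, algebraMap F (AlgebraicClosure F) (α i) * b i = 0 := by
        simp [hα]
      rw [h0, zero_eq_neg, mul_eq_zero] at hP
      rcases hP with h | h
      · exact hx0 h
      · rw [h, algNorm_zero] at hk₁
        exact (zpow_pos hc0 k₁).ne hk₁
    · obtain ⟨k₂, hk₂⟩ := exists_algNorm_sum_eq_zpow b hb1 hind hϖ α hα
      rw [hP, algNorm_neg, algNorm_mul, hk₁] at hk₂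
      apply hx (k₂ - k₁)
      rw [zpow_sub₀ hc0.ne', eq_div_iff (zpow_pos hc0 k₁).ne']
      exact hk₂
  have hα : α = 0 := by
    by_contra hα
    obtain ⟨k₂, hk₂⟩ := exists_algNorm_sum_eq_zpow b hb1 hind hϖ α hα
    have h0 : ∑ i, algebraMap F (AlgebraicClosure F) (γ i) * b i = 0 := by simp [hγ]
    rw [hP, h0, mul_zero, neg_zero, algNorm_zero] at hk₂
    exact (zpow_pos hc0 k₂).ne hk₂
  intro i
  cases i with
  | inl i => exact congrFun hα i
  | inr i => exact congrFun hγ i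


/-! ### The residue algebra of a subextension -/

/-- The **residue algebra** `k_E ⊆ S ⧸ 𝔓` of an intermediate field `E` of `F̄/F`: the residues
of the elements of `E` of norm `≤ 1` (the residue field of the valuation ring `S ∩ E` of `E`), a
`𝓀[F]`-subalgebra of `S ⧸ 𝔓`.  Ref: Serre, *Local Fields*, Ch. I §4 (residue extension
`k_E/k`). [folklore] -/
def residueSubalgebra (E : IntermediateField F (AlgebraicClosure F)) :
    Subalgebra 𝓀[F] (absIntegers 𝒪[F] F ⧸ absMaximalIdeal F) where
  carrier := {v | ∃ y : AlgebraicClosure F, y ∈ E ∧ algNorm F y ≤ 1 ∧ residue F y = v}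
  mul_mem' := by
    rintro _ _ ⟨y, hyE, hy1, rfl⟩ ⟨y', hy'E, hy'1, rfl⟩
    exact ⟨y * y', mul_mem hyE hy'E, by rw [algNorm_mul]; exact mul_le_one₀ hy1 (algNorm_nonneg _) hy'1,
      residue_mul hy1 hy'1⟩
  add_mem' := by
    rintro _ _ ⟨y, hyE, hy1, rfl⟩ ⟨y', hy'E, hy'1, rfl⟩
    exact ⟨y + y', add_mem hyE hy'E, (algNorm_add_le y y').trans (max_le hy1 hy'1), residue_add hy1 hy'1⟩
  algebraMap_mem' c := by
    obtain ⟨a, rfl⟩ := IsLocalRing.residue_surjective c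
    refine ⟨algebraMap 𝒪[F] (AlgebraicClosure F) a, ?_, algNorm_algebraMap_integer a, residue_algebraMap a⟩
    rw [IsScalarTower.algebraMap_apply 𝒪[F] F (AlgebraicClosure F)]
    exact E.algebraMap_mem _

/-- Membership in the residue algebra. [folklore] -/
theorem mem_residueSubalgebra_iff {E : IntermediateField F (AlgebraicClosure F)}
    {v : absIntegers 𝒪[F] F ⧸ absMaximalIdeal F} :
    v ∈ residueSubalgebra E ↔ ∃ y : AlgebraicClosure F, y ∈ E ∧ algNorm F y ≤ 1 ∧ residue F y = v :=
  Iff.rfl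

/-- Residues of elements of `E` of norm `≤ 1` lie in `k_E`. [folklore] -/
theorem residue_mem_residueSubalgebra {E : IntermediateField F (AlgebraicClosure F)}
    {y : AlgebraicClosure F} (hyE : y ∈ E) (hy1 : algNorm F y ≤ 1) :
    residue F y ∈ residueSubalgebra E :=
  ⟨y, hyE, hy1, rfl⟩

/-- `k_E` is a torsion-free `𝓀[F]`-module (a vector space; recorded to keep instance search
fast). [folklore] -/
instance (E : IntermediateField F (AlgebraicClosure F)) :
    Module.IsTorsionFree 𝓀[F] (residueSubalgebra E) :=
  DivisionSemiring.to_moduleIsTorsionFree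

/-- `k_E` is a free `𝓀[F]`-module (a vector space; recorded to keep instance search fast).
[folklore] -/
instance (E : IntermediateField F (AlgebraicClosure F)) : Module.Free 𝓀[F] (residueSubalgebra E) :=
  Module.Free.of_divisionRing _ _

/-- **`f ≤ n`**: a `𝓀[F]`-linearly independent finite family in the residue algebra `k_E` has at
most `[E : F]` elements (lift it and apply `linearIndependent_of_residue`); hence `k_E` is
finite-dimensional of dimension `f ≤ n = [E : F]`.
Ref: Serre, *Local Fields*, Ch. I §4, Prop. 10 / Ch. II §2 (`e f ≤ n`); Neukirch, *ANT*, Ch. II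
(6.8). [cite: SerreLocalFields1979, Ch. II §2 Prop. 3] -/
theorem finite_residueSubalgebra (E : IntermediateField F (AlgebraicClosure F)) [FiniteDimensional F E] :
    Module.Finite 𝓀[F] (residueSubalgebra E) ∧
      Module.finrank 𝓀[F] (residueSubalgebra E) ≤ Module.finrank F E := by
  have key : ∀ s : Finset (residueSubalgebra E),
      (LinearIndependent 𝓀[F] fun i : s => (i : residueSubalgebra E)) → s.card ≤ Module.finrank F E := by
    intro s hs
    -- lift the elements of `s`
    have hmem : ∀ i : s, ∃ y : AlgebraicClosure F, y ∈ E ∧ algNorm F y ≤ 1 ∧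
        residue F y = ((i : residueSubalgebra E) : absIntegers 𝒪[F] F ⧸ absMaximalIdeal F) :=
      fun i => (i : residueSubalgebra E).2
    choose b hbE hb1 hbr using hmem
    have hind : LinearIndependent 𝓀[F] (fun i : s => residue F (b i)) := by
      have h := hs.map' (residueSubalgebra E).val.toLinearMap
        (LinearMap.ker_eq_bot.mpr Subtype.val_injective)
      have heq : ((residueSubalgebra E).val.toLinearMap ∘ fun i : s => (i : residueSubalgebra E)) =
          fun i : s => residue F (b i) := funext fun i => (hbr i).symm
      rwa [heq] at h
    have hF := linearIndependent_of_residue b hb1 hind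
    -- as a family in `E`
    have hF' : LinearIndependent F (fun i : s => (⟨b i, hbE i⟩ : E)) :=
      LinearIndependent.of_comp E.val.toLinearMap (by exact hF)
    have := hF'.fintype_card_le_finrank
    rwa [Fintype.card_coe] at this
  have hrank : Module.rank 𝓀[F] (residueSubalgebra E) ≤ Module.finrank F E := rank_le key
  have hfin : Module.Finite 𝓀[F] (residueSubalgebra E) :=
    Module.rank_lt_aleph0_iff.mp (hrank.trans_lt (Cardinal.natCast_lt_aleph0))
  exact ⟨hfin, Module.finrank_le_of_rank_le hrank⟩

/-- `k_E` is finite-dimensional over `𝓀[F]` for `E/F` finite. [folklore] -/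
instance (E : IntermediateField F (AlgebraicClosure F)) [FiniteDimensional F E] :
    Module.Finite 𝓀[F] (residueSubalgebra E) :=
  (finite_residueSubalgebra E).1

/-- `f = dim k_E ≤ n = [E : F]`. Ref: Serre, *Local Fields*, Ch. I §4, Prop. 10. [folklore] -/
theorem finrank_residueSubalgebra_le (E : IntermediateField F (AlgebraicClosure F))
    [FiniteDimensional F E] : Module.finrank 𝓀[F] (residueSubalgebra E) ≤ Module.finrank F E :=
  (finite_residueSubalgebra E).2

/-- `f = dim k_E ≥ 1` (`k_E ∋ 1 ≠ 0`). [folklore] -/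
theorem finrank_residueSubalgebra_pos (E : IntermediateField F (AlgebraicClosure F))
    [FiniteDimensional F E] : 0 < Module.finrank 𝓀[F] (residueSubalgebra E) :=
  Module.finrank_pos

/-! ### Embeddings act on the residue algebra -/

section ResidueAlgHom

variable {E : IntermediateField F (AlgebraicClosure F)}

/-- Every element of `k_E` lifts to an element of `E` of norm `≤ 1`. [folklore] -/
theorem exists_lift_of_mem_residueSubalgebra (v : residueSubalgebra E) :
    ∃ y : E, algNorm F (y : AlgebraicClosure F) ≤ 1 ∧ residue F (y : AlgebraicClosure F) = v := by
  obtain ⟨y, hyE, hy1, hyv⟩ := v.2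
  exact ⟨⟨y, hyE⟩, hy1, hyv⟩

/-- The function underlying `residueAlgHom φ`: `v ↦ residue (φ y)` for a chosen lift `y` of `v`.
[folklore] -/
def residueLift (φ : E →ₐ[F] AlgebraicClosure F) (v : residueSubalgebra E) :
    absIntegers 𝒪[F] F ⧸ absMaximalIdeal F :=
  residue F (φ (exists_lift_of_mem_residueSubalgebra v).choose)

/-- `residueLift φ` does not depend on the lift: `residueLift φ (residue y) = residue (φ y)` for
every `y ∈ E` of norm `≤ 1` (embeddings preserve congruences modulo `𝔓`). [folklore] -/
theorem residueLift_eq (φ : E →ₐ[F] AlgebraicClosure F) (v : residueSubalgebra E) {y : E}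
    (hy : algNorm F (y : AlgebraicClosure F) ≤ 1) (hyv : residue F (y : AlgebraicClosure F) = v) :
    residueLift φ v = residue F (φ y) := by
  have h := (exists_lift_of_mem_residueSubalgebra v).choose_spec
  exact residue_algHom_eq_of_residue_eq E φ h.1 hy (h.2.trans hyv.symm)

/-- Embeddings preserve the closed unit ball. [folklore] -/
theorem algNorm_algHom_le_one (φ : E →ₐ[F] AlgebraicClosure F) {y : E}
    (hy : algNorm F (y : AlgebraicClosure F) ≤ 1) : algNorm F (φ y) ≤ 1 := by
  rw [algNorm_algHom_apply]; exact hy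

/-- The ring homomorphism `k_E → S ⧸ 𝔓` induced by an embedding `φ : E → F̄`
(`residue y ↦ residue (φ y)`).  Ref: Serre, *Local Fields*, Ch. I §7 (action of embeddings on
residue fields). [folklore] -/
def residueRingHom (φ : E →ₐ[F] AlgebraicClosure F) :
    residueSubalgebra E →+* (absIntegers 𝒪[F] F ⧸ absMaximalIdeal F) where
  toFun := residueLift φ
  map_one' := by
    rw [residueLift_eq φ (1 : residueSubalgebra E) (y := 1) (by simp) (by simp), map_one, residue_one]
  map_mul' v w := by
    obtain ⟨yv, hv1, hv⟩ := exists_lift_of_mem_residueSubalgebra v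
    obtain ⟨yw, hw1, hw⟩ := exists_lift_of_mem_residueSubalgebra w
    have h1 : algNorm F ((yv * yw : E) : AlgebraicClosure F) ≤ 1 := by
      push_cast; rw [algNorm_mul]; exact mul_le_one₀ hv1 (algNorm_nonneg _) hw1
    have h2 : residue F ((yv * yw : E) : AlgebraicClosure F) = (v * w : residueSubalgebra E) := by
      push_cast; rw [residue_mul hv1 hw1, hv, hw]
    rw [residueLift_eq φ _ h1 h2, residueLift_eq φ v hv1 hv, residueLift_eq φ w hw1 hw, map_mul,
      residue_mul (algNorm_algHom_le_one φ hv1) (algNorm_algHom_le_one φ hw1)]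
  map_zero' := by
    rw [residueLift_eq φ (0 : residueSubalgebra E) (y := 0) (by simp) (by simp), map_zero, residue_zero]
  map_add' v w := by
    obtain ⟨yv, hv1, hv⟩ := exists_lift_of_mem_residueSubalgebra v
    obtain ⟨yw, hw1, hw⟩ := exists_lift_of_mem_residueSubalgebra w
    have h1 : algNorm F ((yv + yw : E) : AlgebraicClosure F) ≤ 1 := by
      push_cast; exact (algNorm_add_le _ _).trans (max_le hv1 hw1)
    have h2 : residue F ((yv + yw : E) : AlgebraicClosure F) = (v + w : residueSubalgebra E) := by
      push_cast; rw [residue_add hv1 hw1, hv, hw]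
    rw [residueLift_eq φ _ h1 h2, residueLift_eq φ v hv1 hv, residueLift_eq φ w hw1 hw, map_add,
      residue_add (algNorm_algHom_le_one φ hv1) (algNorm_algHom_le_one φ hw1)]

/-- Unfolding lemma for `residueRingHom`. [folklore] -/
theorem residueRingHom_apply (φ : E →ₐ[F] AlgebraicClosure F) (v : residueSubalgebra E) :
    residueRingHom φ v = residueLift φ v := rfl

/-- `residueLift φ` fixes the image of `𝓀[F]` (`φ` fixes `F`). [folklore] -/
theorem residueLift_algebraMap (φ : E →ₐ[F] AlgebraicClosure F) (a : 𝒪[F]) :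
    residueLift φ (algebraMap 𝓀[F] (residueSubalgebra E) (IsLocalRing.residue 𝒪[F] a)) =
      algebraMap 𝓀[F] _ (IsLocalRing.residue 𝒪[F] a) := by
  have haE : algebraMap 𝒪[F] (AlgebraicClosure F) a ∈ E := by
    rw [IsScalarTower.algebraMap_apply 𝒪[F] F (AlgebraicClosure F)]; exact E.algebraMap_mem _
  have h2 : residue F ((⟨_, haE⟩ : E) : AlgebraicClosure F) =
      ((algebraMap 𝓀[F] (residueSubalgebra E) (IsLocalRing.residue 𝒪[F] a) : residueSubalgebra E) :
        absIntegers 𝒪[F] F ⧸ absMaximalIdeal F) := by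
    rw [Subalgebra.coe_algebraMap]; exact residue_algebraMap a
  rw [residueLift_eq φ _ (y := ⟨_, haE⟩) (algNorm_algebraMap_integer a) h2]
  have hE : (⟨_, haE⟩ : E) = algebraMap F E (a : F) := Subtype.ext rfl
  rw [hE, AlgHom.commutes]
  exact residue_algebraMap a

/-- The **`𝓀[F]`-algebra homomorphism `k_E → S ⧸ 𝔓` induced by an `F`-embedding
`φ : E → F̄`**: `residue y ↦ residue (φ y)`.  Ref: Serre, *Local Fields*, Ch. I §7, Prop. 20–21
(embeddings/automorphisms act on the residue extension). [folklore] -/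
def residueAlgHom (φ : E →ₐ[F] AlgebraicClosure F) :
    residueSubalgebra E →ₐ[𝓀[F]] (absIntegers 𝒪[F] F ⧸ absMaximalIdeal F) :=
  { residueRingHom φ with
    commutes' := fun c => by
      obtain ⟨a, rfl⟩ := IsLocalRing.residue_surjective c
      exact residueLift_algebraMap φ a }

/-- Defining property of `residueAlgHom`: `residue y ↦ residue (φ y)`. [folklore] -/
theorem residueAlgHom_apply (φ : E →ₐ[F] AlgebraicClosure F) {y : E}
    (hy : algNorm F (y : AlgebraicClosure F) ≤ 1) :
    residueAlgHom φ ⟨residue F (y : AlgebraicClosure F), residue_mem_residueSubalgebra y.2 hy⟩ =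
      residue F (φ y) :=
  residueLift_eq φ ⟨residue F (y : AlgebraicClosure F), residue_mem_residueSubalgebra y.2 hy⟩ hy rfl

/-- Two embeddings inducing the same map on `k_E` are congruent modulo `𝔓` on the elements of
`E` of norm `≤ 1`. [folklore] -/
theorem algNorm_sub_lt_one_of_residueAlgHom_eq {φ ψ : E →ₐ[F] AlgebraicClosure F}
    (h : residueAlgHom φ = residueAlgHom ψ) {y : E} (hy : algNorm F (y : AlgebraicClosure F) ≤ 1) :
    algNorm F (φ y - ψ y) < 1 := by
  have := DFunLike.congr_fun h ⟨residue F (y : AlgebraicClosure F), residue_mem_residueSubalgebra y.2 hy⟩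
  rw [residueAlgHom_apply φ hy, residueAlgHom_apply ψ hy] at this
  exact (residue_eq_residue_iff (algNorm_algHom_le_one φ hy) (algNorm_algHom_le_one ψ hy)).mp this

end ResidueAlgHom

/-! ### `F(μ_N)/F` is unramified for `N` prime to `p` -/

/-- A root of unity has norm `1`. [folklore] -/
theorem algNorm_eq_one_of_pow_eq_one {N : ℕ} (hN : N ≠ 0) {ζ : AlgebraicClosure F} (hζ : ζ ^ N = 1) :
    algNorm F ζ = 1 := by
  have h := congrArg (algNorm F) hζ
  rw [algNorm_pow, algNorm_one] at h
  exact (pow_eq_one_iff_of_nonneg (algNorm_nonneg ζ) hN).mp h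

/-- **An embedding of `F⟮ζ⟯` is determined by its action on the residue algebra** when `ζ` is a
root of unity of order prime to `p`: embeddings congruent modulo `𝔓` send `ζ` to roots of unity
congruent modulo `𝔓`, hence equal (`eq_one_of_pow_eq_one_of_algNorm_sub_one_lt_one`).
Ref: Serre, *Local Fields*, Ch. IV §4, proof of Prop. 16 ("`s(z) ≡ z^q` implies `s(z) = z^q`").
[cite: SerreLocalFields1979, Ch. IV §4 Prop. 16] -/
theorem residueAlgHom_injective_adjoin_rootOfUnity {N : ℕ} (hN : IsUnit ((N : ℕ) : 𝒪[F]))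
    {ζ : AlgebraicClosure F} (hζ : ζ ^ N = 1) :
    Function.Injective (fun φ : F⟮ζ⟯ →ₐ[F] AlgebraicClosure F => residueAlgHom φ) := by
  intro φ ψ h
  have hN0 : N ≠ 0 := by rintro rfl; simp at hN
  have hζ1 : algNorm F ζ = 1 := algNorm_eq_one_of_pow_eq_one hN0 hζ
  set g : F⟮ζ⟯ := ⟨ζ, IntermediateField.mem_adjoin_simple_self F ζ⟩ with hg
  have hsub : algNorm F (φ g - ψ g) < 1 := algNorm_sub_lt_one_of_residueAlgHom_eq h (by rw [hg]; exact hζ1.le)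
  have hφN : φ g ^ N = 1 := by rw [← map_pow]; convert map_one φ; exact Subtype.ext hζ
  have hψN : ψ g ^ N = 1 := by rw [← map_pow]; convert map_one ψ; exact Subtype.ext hζ
  have hψ0 : ψ g ≠ 0 := by intro h0; rw [h0, zero_pow hN0] at hψN; exact zero_ne_one hψN
  have hψ1 : algNorm F (ψ g) = 1 := algNorm_eq_one_of_pow_eq_one hN0 hψN
  -- `η = φ g / ψ g` is an `N`-th root of unity with `‖η - 1‖ < 1`
  have hη : (φ g / ψ g) ^ N = 1 := by rw [div_pow, hφN, hψN, div_one]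
  have hη1 : algNorm F (φ g / ψ g - 1) < 1 := by
    have : φ g / ψ g - 1 = (φ g - ψ g) / ψ g := by field_simp
    rw [this, algNorm_div, hψ1, div_one]
    exact hsub
  have heq : φ g = ψ g := by
    have := eq_one_of_pow_eq_one_of_algNorm_sub_one_lt_one hN hη hη1
    rwa [div_eq_one_iff_eq hψ0] at this
  refine IntermediateField.adjoin_algHom_ext F (fun x hx => ?_)
  rw [Set.mem_singleton_iff] at hx
  subst hx
  exact heq

/-- **`F(ζ)/F` is unramified for a root of unity `ζ` of order `N` prime to `p`** (`N` a unit of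
`𝒪[F]`): every non-zero `x ∈ F⟮ζ⟯` has `‖x‖ = ‖ϖ‖ ^ n` for some `n : ℤ`.  Proof by counting (see
the module docstring): `n = [F⟮ζ⟯ : F] = #Emb(F⟮ζ⟯, F̄) ≤ #Hom_{𝓀[F]}(k_E, S ⧸ 𝔓) ≤ f`, while an
`x` of norm outside `‖ϖ‖ ^ ℤ` would give `2 f ≤ n`.
Ref: Serre, *Local Fields*, Ch. IV §4, Prop. 16 ("The field `K_n` is an unramified extension of
`K`"); Neukirch, *ANT*, Ch. II (7.12)–(7.13).
[cite: SerreLocalFields1979, Ch. IV §4 Prop. 16] -/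
theorem exists_algNorm_eq_zpow_of_mem_adjoin_rootOfUnity {N : ℕ} (hN : IsUnit ((N : ℕ) : 𝒪[F]))
    {ζ : AlgebraicClosure F} (hζ : ζ ^ N = 1) {ϖ : 𝒪[F]} (hϖ : Irreducible ϖ)
    {x : AlgebraicClosure F} (hx : x ∈ F⟮ζ⟯) (hx0 : x ≠ 0) :
    ∃ n : ℤ, algNorm F x = algNorm F (algebraMap 𝒪[F] (AlgebraicClosure F) ϖ) ^ n := by
  by_contra hcon
  push Not at hcon
  have hN0 : N ≠ 0 := by rintro rfl; simp at hN
  have hNF : ((N : ℕ) : F) ≠ 0 := by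
    have hu := hN.map (algebraMap 𝒪[F] F)
    rw [map_natCast] at hu
    exact hu.ne_zero
  -- `E = F⟮ζ⟯` is finite and separable over `F`
  have hζi : IsIntegral F ζ := IsIntegral.of_pow (Nat.pos_of_ne_zero hN0) (by rw [hζ]; exact isIntegral_one)
  haveI : FiniteDimensional F F⟮ζ⟯ := IntermediateField.adjoin.finiteDimensional hζi
  have hsep : IsSeparable F ζ := by
    have h1 : (Polynomial.X ^ N - Polynomial.C (1 : F)).Separable :=
      Polynomial.separable_X_pow_sub_C 1 hNF one_ne_zero
    exact h1.of_dvd (minpoly.dvd F ζ (by simp [hζ]))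
  haveI : Algebra.IsSeparable F F⟮ζ⟯ :=
    (IntermediateField.isSeparable_adjoin_simple_iff_isSeparable F (AlgebraicClosure F)).mpr hsep
  set V := residueSubalgebra F⟮ζ⟯ with hV
  -- (a) `[E : F] ≤ dim V` by counting embeddings
  have ha : Module.finrank F F⟮ζ⟯ ≤ Module.finrank 𝓀[F] V := by
    rw [← AlgHom.card F F⟮ζ⟯ (AlgebraicClosure F), Fintype.card_eq_nat_card]
    exact (Nat.card_le_card_of_injective _ (residueAlgHom_injective_adjoin_rootOfUnity hN hζ)).trans
      (card_algHom_le_finrank 𝓀[F] V (absIntegers 𝒪[F] F ⧸ absMaximalIdeal F))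
  -- (b) `2 dim V ≤ [E : F]` by the lifting lemma and `x`
  have hb : 2 * Module.finrank 𝓀[F] V ≤ Module.finrank F F⟮ζ⟯ := by
    set bV := Module.finBasis 𝓀[F] V
    have hmem : ∀ i, ∃ y : AlgebraicClosure F, y ∈ F⟮ζ⟯ ∧ algNorm F y ≤ 1 ∧
        residue F y = ((bV i : V) : absIntegers 𝒪[F] F ⧸ absMaximalIdeal F) := fun i => (bV i).2
    choose b hbE hb1 hbr using hmem
    have hind : LinearIndependent 𝓀[F] (fun i => residue F (b i)) := by
      have h := bV.linearIndependent.map' V.val.toLinearMap (LinearMap.ker_eq_bot.mpr Subtype.val_injective)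
      have heq : (V.val.toLinearMap ∘ bV) = fun i => residue F (b i) := funext fun i => (hbr i).symm
      rwa [heq] at h
    have hli := linearIndependent_sum_of_residue_of_algNorm b hb1 hind hϖ hx0 hcon
    have hli' : LinearIndependent F (Sum.elim (fun i => (⟨b i, hbE i⟩ : F⟮ζ⟯))
        (fun i => (⟨x * b i, mul_mem hx (hbE i)⟩ : F⟮ζ⟯))) := by
      refine LinearIndependent.of_comp (F⟮ζ⟯).val.toLinearMap ?_
      convert hli using 1
      funext i
      cases i <;> rfl
    have := hli'.fintype_card_le_finrank
    simpa [Fintype.card_sum, two_mul] using this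
  have hpos : 0 < Module.finrank 𝓀[F] V := finrank_residueSubalgebra_pos F⟮ζ⟯
  omega

/-! ### The maximal unramified extension `F_nr = F(μ_{p'})` and the Kummer extensions `F_nr(ϖ^{1/d})` -/

variable (F) in
/-- The set `μ_{p'}(F̄)` of roots of unity of order prime to `p` (of order `N` a unit of `𝒪[F]`).
Ref: Serre, *Local Fields*, Ch. IV §4, Cor. 2 to Prop. 16. [folklore] -/
def primeToPRootsOfUnity : Set (AlgebraicClosure F) :=
  {ζ | ∃ N : ℕ, IsUnit ((N : ℕ) : 𝒪[F]) ∧ ζ ^ N = 1}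

variable (F) in
/-- **`F_nr = F(μ_{p'})`**, the subfield of `F̄` generated over `F` by the roots of unity of order
prime to `p`.  By Serre, *Local Fields*, Ch. IV §4, Cor. 2 to Prop. 16 this is the maximal
unramified extension `K_nr` of `F`; here it is *defined* this way, its unramifiedness
(`exists_algNorm_eq_zpow_of_mem_maxUnramified`) and the identity `Aut(F̄/F_nr) = I_F`
(`mem_absInertia_iff_forall_mem_maxUnramified`) being theorems.
[cite: SerreLocalFields1979, Ch. IV §4 Cor. 2 to Prop. 16] -/
def maxUnramified : IntermediateField F (AlgebraicClosure F) :=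
  IntermediateField.adjoin F (primeToPRootsOfUnity F)

omit [TopologicalSpace F] [IsNonarchimedeanLocalField F] in
/-- Membership in `μ_{p'}(F̄)`. [folklore] -/
theorem mem_primeToPRootsOfUnity_iff {ζ : AlgebraicClosure F} :
    ζ ∈ primeToPRootsOfUnity F ↔ ∃ N : ℕ, IsUnit ((N : ℕ) : 𝒪[F]) ∧ ζ ^ N = 1 := Iff.rfl

/-- **`I_F = Aut(F̄/F_nr)`**: `σ ∈ I_F` iff `σ` fixes `F_nr = F(μ_{p'})` pointwise
(`mem_absInertia_iff_smul_rootsOfUnity` and induction over `IntermediateField.adjoin`).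
Ref: Serre, Invent. Math. 15 (1972), §1.2 (`I = Gal(K_s/K_nr)`); Serre, *Local Fields*, Ch. IV
§4, Cor. 2 to Prop. 16. [cite: SerreInventiones1972, §1.2] -/
theorem mem_absInertia_iff_forall_mem_maxUnramified {σ : absoluteGaloisGroup F} :
    σ ∈ absInertia F ↔ ∀ x ∈ maxUnramified F, σ • x = x := by
  rw [mem_absInertia_iff_smul_rootsOfUnity]
  constructor
  · intro h x hx
    refine IntermediateField.adjoin_induction (F := F) (s := primeToPRootsOfUnity F)
      (p := fun y _ => σ • y = y) ?_ ?_ ?_ ?_ ?_ hx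
    · rintro y ⟨N, hN, hyN⟩; exact h N hN y hyN
    · intro y
      rw [absoluteGaloisGroup.smul_def]; exact AlgEquiv.commutes _ y
    · intro y w _ _ hy hw; rw [smul_add, hy, hw]
    · intro y _ hy; rw [smul_inv'', hy]
    · intro y w _ _ hy hw; rw [smul_mul', hy, hw]
  · intro h N hN ζ hζ
    exact h ζ (IntermediateField.subset_adjoin F _ ⟨N, hN, hζ⟩)

/-- **`F_nr / F` is unramified**: every non-zero element of `F_nr = F(μ_{p'})` has norm in
`‖ϖ‖ ^ ℤ` (it lies in some `F⟮ζ₀⟯`, `ζ₀` a primitive `N`-th root of unity with `N` prime to `p`: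
`IntermediateField.exists_finset_of_mem_adjoin` and `IsPrimitiveRoot.eq_pow_of_pow_eq_one`).
Ref: Serre, *Local Fields*, Ch. IV §4, Prop. 16 and Cor. 2; Serre, Invent. Math. 15 (1972),
§1.2 ("`K_nr` … la plus grande sous-extension de `K_s` non ramifiée sur `K`").
[cite: SerreLocalFields1979, Ch. IV §4 Prop. 16 and Cor. 2] -/
theorem exists_algNorm_eq_zpow_of_mem_maxUnramified {ϖ : 𝒪[F]} (hϖ : Irreducible ϖ)
    {x : AlgebraicClosure F} (hx : x ∈ maxUnramified F) (hx0 : x ≠ 0) :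
    ∃ n : ℤ, algNorm F x = algNorm F (algebraMap 𝒪[F] (AlgebraicClosure F) ϖ) ^ n := by
  classical
  obtain ⟨T, hT, hxT⟩ := IntermediateField.exists_finset_of_mem_adjoin hx
  -- a common order `N`, prime to `p`
  have hN : ∀ t : T, ∃ N : ℕ, IsUnit ((N : ℕ) : 𝒪[F]) ∧ (t : AlgebraicClosure F) ^ N = 1 :=
    fun t => hT t.2
  choose Nt hNtu hNt using hN
  set N := ∏ t : T, Nt t with hNdef
  have hNu : IsUnit ((N : ℕ) : 𝒪[F]) := by
    rw [hNdef, Nat.cast_prod]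
    exact Finset.prod_induction _ IsUnit (fun a b ha hb => ha.mul hb) isUnit_one (fun t _ => hNtu t)
  have hN0 : N ≠ 0 := by rintro h0; rw [h0] at hNu; simp at hNu
  have hTN : ∀ t : T, (t : AlgebraicClosure F) ^ N = 1 := fun t => by
    obtain ⟨m, hm⟩ : Nt t ∣ N := Finset.dvd_prod_of_mem _ (Finset.mem_univ t)
    rw [hm, pow_mul, hNt, one_pow]
  -- a primitive `N`-th root of unity `ζ₀`; `T ⊆ F⟮ζ₀⟯`
  haveI : NeZero ((N : ℕ) : AlgebraicClosure F) := ⟨by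
    have hu := hNu.map (algebraMap 𝒪[F] (AlgebraicClosure F))
    rw [map_natCast] at hu
    exact hu.ne_zero⟩
  haveI : NeZero N := ⟨hN0⟩
  obtain ⟨ζ₀, hζ₀⟩ := HasEnoughRootsOfUnity.exists_primitiveRoot (AlgebraicClosure F) N
  have hle : IntermediateField.adjoin F (T : Set (AlgebraicClosure F)) ≤ F⟮ζ₀⟯ := by
    rw [IntermediateField.adjoin_le_iff]
    intro t ht
    obtain ⟨i, -, hi⟩ := hζ₀.eq_pow_of_pow_eq_one (hTN ⟨t, ht⟩)
    change t ∈ F⟮ζ₀⟯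
    rw [show t = ζ₀ ^ i from hi.symm]
    exact pow_mem (IntermediateField.mem_adjoin_simple_self F ζ₀) i
  exact exists_algNorm_eq_zpow_of_mem_adjoin_rootOfUnity hNu hζ₀.pow_eq_one hϖ (hle hxT) hx0

/-- **Ultrametric sums with pairwise distinct norms**: if the non-zero terms of a finite sum have
pairwise distinct norms and the sum vanishes, then all terms vanish (the term of largest norm
dominates: `‖t + r‖ = ‖t‖` for `‖r‖ < ‖t‖`).  Ref: Neukirch, *ANT*, Ch. II §3 (strict triangle
inequality). [folklore] -/
theorem eq_zero_of_sum_eq_zero_of_algNorm_injOn {ι : Type*} (s : Finset ι) (t : ι → AlgebraicClosure F)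
    (hdist : ∀ i ∈ s, ∀ j ∈ s, t i ≠ 0 → t j ≠ 0 → algNorm F (t i) = algNorm F (t j) → i = j)
    (hsum : ∑ i ∈ s, t i = 0) : ∀ i ∈ s, t i = 0 := by
  classical
  by_contra hne
  push Not at hne
  obtain ⟨i₁, hi₁s, hi₁⟩ := hne
  -- a term of maximal norm
  obtain ⟨i₀, hi₀s, hi₀⟩ := Finset.exists_max_image s (fun i => algNorm F (t i)) ⟨i₁, hi₁s⟩
  have ht0 : t i₀ ≠ 0 := by
    intro h0
    have := hi₀ i₁ hi₁s
    rw [h0, algNorm_zero] at this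
    exact hi₁ (algNorm_eq_zero_iff.mp (le_antisymm this (algNorm_nonneg _)))
  have hpos : 0 < algNorm F (t i₀) := algNorm_pos_iff.mpr ht0
  -- all other terms have strictly smaller norm
  have hlt : ∀ j ∈ s.erase i₀, algNorm F (t j) < algNorm F (t i₀) := by
    intro j hj
    obtain ⟨hji, hjs⟩ := Finset.mem_erase.mp hj
    by_cases htj : t j = 0
    · rw [htj, algNorm_zero]; exact hpos
    · exact lt_of_le_of_ne (hi₀ j hjs) fun heq => hji (hdist j hjs i₀ hi₀s htj ht0 heq)
  -- strict ultrametric bound for the rest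
  have hrest : algNorm F (∑ j ∈ s.erase i₀, t j) < algNorm F (t i₀) := by
    have key : ∀ (u : Finset ι), (∀ j ∈ u, algNorm F (t j) < algNorm F (t i₀)) →
        algNorm F (∑ j ∈ u, t j) < algNorm F (t i₀) := by
      intro u
      induction u using Finset.induction_on with
      | empty => intro _; simpa using hpos
      | insert a u ha ih =>
        intro hu
        rw [Finset.sum_insert ha]
        exact (algNorm_add_le _ _).trans_lt (max_lt (hu a (Finset.mem_insert_self a u))
          (ih fun j hj => hu j (Finset.mem_insert_of_mem hj)))
    exact key _ hlt
  have hsplit : ∑ i ∈ s, t i = t i₀ + ∑ j ∈ s.erase i₀, t j := (Finset.add_sum_erase s t hi₀s).symm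
  rw [hsplit] at hsum
  have := algNorm_add_eq_left hrest
  rw [hsum, algNorm_zero] at this
  exact hpos.ne this

/-- **`X ^ d - ϖ` stays irreducible over `F_nr`** (`ϖ` a uniformiser, any `d ≥ 1`), in the form:
the powers `z ^ i`, `i < d`, of a root `z` of `z ^ d = ϖ` are `F_nr`-linearly independent — the
non-zero terms `m_i z ^ i` of a relation have pairwise distinct norms `‖ϖ‖ ^ (n_i + i/d)`
(`‖m_i‖ = ‖ϖ‖ ^ n_i` by `exists_algNorm_eq_zpow_of_mem_maxUnramified`, `‖z‖ ^ d = ‖ϖ‖`), so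
`eq_zero_of_sum_eq_zero_of_algNorm_injOn` applies.  This is the Eisenstein/valuation argument
behind "`K_d/K_nr` est totalement ramifiée … de degré `d`".
Ref: Serre, Invent. Math. 15 (1972), §1.3; Serre, *Local Fields*, Ch. I §6 (Eisenstein
polynomials, totally ramified extensions). [cite: SerreInventiones1972, §1.3] -/
theorem linearIndependent_pow_of_pow_eq_uniformizer {d : ℕ} (hd : 0 < d) {ϖ : 𝒪[F]} (hϖ : Irreducible ϖ)
    {z : AlgebraicClosure F} (hz : z ^ d = algebraMap 𝒪[F] (AlgebraicClosure F) ϖ)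
    (m : Fin d → maxUnramified F) (hm : ∑ i, ((m i : AlgebraicClosure F)) * z ^ (i : ℕ) = 0) :
    ∀ i, m i = 0 := by
  have hc0 := algNorm_uniformizer_pos hϖ
  have hc1 := algNorm_uniformizer_lt_one hϖ
  have hzd : algNorm F z ^ d = algNorm F (algebraMap 𝒪[F] (AlgebraicClosure F) ϖ) := by
    rw [← algNorm_pow, hz]
  have hz0 : z ≠ 0 := by
    intro h; rw [h, zero_pow hd.ne'] at hz
    exact (algNorm_pos_iff.mp hc0) hz.symm
  have key := eq_zero_of_sum_eq_zero_of_algNorm_injOn Finset.univ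
    (fun i : Fin d => ((m i : AlgebraicClosure F)) * z ^ (i : ℕ)) ?_ hm
  · intro i
    have := key i (Finset.mem_univ i)
    rcases mul_eq_zero.mp this with h | h
    · exact_mod_cast h
    · exact absurd h (pow_ne_zero _ hz0)
  -- distinct norms
  intro i _ j _ hi hj heq
  have hmi : (m i : AlgebraicClosure F) ≠ 0 := fun h => hi (by simp [h])
  have hmj : (m j : AlgebraicClosure F) ≠ 0 := fun h => hj (by simp [h])
  obtain ⟨a, ha⟩ := exists_algNorm_eq_zpow_of_mem_maxUnramified hϖ (m i).2 hmi
  obtain ⟨b, hb⟩ := exists_algNorm_eq_zpow_of_mem_maxUnramified hϖ (m j).2 hmj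
  -- take `d`-th powers: `c ^ (a d + i) = c ^ (b d + j)`
  set c := algNorm F (algebraMap 𝒪[F] (AlgebraicClosure F) ϖ) with hcdef
  have hzi : ∀ k : ℕ, (algNorm F z ^ k) ^ d = c ^ k := fun k => by
    rw [← pow_mul, mul_comm, pow_mul, hzd]
  have hpow : c ^ (a * d + (i : ℕ) : ℤ) = c ^ (b * d + (j : ℕ) : ℤ) := by
    have h := congrArg (fun r => r ^ d) heq
    simp only [algNorm_mul, algNorm_pow, mul_pow, ha, hb, hzi] at h
    rw [zpow_add₀ hc0.ne', zpow_add₀ hc0.ne', zpow_mul, zpow_mul, zpow_natCast, zpow_natCast,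
      zpow_natCast, zpow_natCast]
    exact h
  rw [zpow_right_inj₀ hc0 hc1.ne] at hpow
  -- `a d + i = b d + j` with `i, j < d`
  apply Fin.ext
  have h1 : ((a * d + i : ℤ) % d) = ((b * d + j : ℤ) % d) := by rw [hpow]
  rw [Int.add_comm, Int.add_mul_emod_self_right, Int.add_comm, Int.add_mul_emod_self_right] at h1
  have hi' : ((i : ℕ) : ℤ) % d = i := Int.emod_eq_of_lt (by positivity) (by exact_mod_cast i.2)
  have hj' : ((j : ℕ) : ℤ) % d = j := Int.emod_eq_of_lt (by positivity) (by exact_mod_cast j.2)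
  rw [hi', hj'] at h1
  exact_mod_cast h1

/-- **The minimal polynomial of a root `z` of `z ^ d = ϖ` over `F_nr` is `X ^ d - ϖ`** (`ϖ` a
uniformiser, `d ≥ 1`): `[F_nr(ϖ^{1/d}) : F_nr] = d`, i.e. `K_d/K_nr` is (totally ramified) of
degree `d`.  Ref: Serre, Invent. Math. 15 (1972), §1.3 ("L'extension `K_d/K_nr` est totalement
ramifiée, modérée, et de degré `d`"). [cite: SerreInventiones1972, §1.3] -/
theorem minpoly_maxUnramified_eq {d : ℕ} (hd : 0 < d) {ϖ : 𝒪[F]} (hϖ : Irreducible ϖ)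
    {z : AlgebraicClosure F} (hz : z ^ d = algebraMap 𝒪[F] (AlgebraicClosure F) ϖ) :
    minpoly (maxUnramified F) z =
      Polynomial.X ^ d - Polynomial.C (⟨algebraMap 𝒪[F] (AlgebraicClosure F) ϖ, by
        rw [IsScalarTower.algebraMap_apply 𝒪[F] F (AlgebraicClosure F)]
        exact (maxUnramified F).algebraMap_mem _⟩ : maxUnramified F) := by
  set M := maxUnramified F
  set ϖM : M := ⟨algebraMap 𝒪[F] (AlgebraicClosure F) ϖ, by
        rw [IsScalarTower.algebraMap_apply 𝒪[F] F (AlgebraicClosure F)]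
        exact (maxUnramified F).algebraMap_mem _⟩ with hϖM
  set q : Polynomial M := Polynomial.X ^ d - Polynomial.C ϖM with hq
  have hqm : q.Monic := Polynomial.monic_X_pow_sub_C ϖM hd.ne'
  have hqdeg : q.natDegree = d := Polynomial.natDegree_X_pow_sub_C
  have hqz : Polynomial.aeval z q = 0 := by
    rw [hq, map_sub, map_pow, Polynomial.aeval_X, Polynomial.aeval_C, hz, sub_eq_zero]
    rfl
  have hzi : IsIntegral M z := ⟨q, hqm, by rwa [Polynomial.aeval_def] at hqz⟩
  have hpm : (minpoly M z).Monic := minpoly.monic hzi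
  have hdvd : minpoly M z ∣ q := minpoly.dvd M z hqz
  -- degree `≥ d`: the powers `z ^ i`, `i < d`, are `M`-independent
  have hdeg : d ≤ (minpoly M z).natDegree := by
    by_contra hlt
    push Not at hlt
    have hsum := minpoly.aeval M z
    rw [Polynomial.aeval_eq_sum_range' hlt, Finset.sum_range] at hsum
    simp only [Algebra.smul_def] at hsum
    have h0 := linearIndependent_pow_of_pow_eq_uniformizer hd hϖ hz (fun i => (minpoly M z).coeff i)
      (by simpa using hsum)
    -- the leading coefficient is `1 ≠ 0`
    have hlead := h0 ⟨(minpoly M z).natDegree, hlt⟩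
    simp only [Polynomial.coeff_natDegree, hpm.leadingCoeff] at hlead
    exact one_ne_zero hlead
  symm
  exact Polynomial.eq_of_monic_of_dvd_of_natDegree_le hpm hqm hdvd (by rw [hqdeg]; exact hdeg)

/-- **Surjectivity of the Kummer character `θ_d : I_F → μ_d`**: for `d ≥ 1`, a uniformiser `ϖ`,
a root `z ∈ F̄` of `z ^ d = ϖ` and any `ζ ∈ F̄` with `ζ ^ d = 1`, some `σ ∈ I_F` satisfies
`σ z = ζ z`.  (`ζ z` is a root of `X ^ d - ϖ = minpoly_{F_nr}(z)`, hence `σ z = ζ z` for some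
`σ ∈ Aut(F̄/F_nr)` by Mathlib's `minpoly.exists_algEquiv_of_root'`, and `Aut(F̄/F_nr) = I_F`.)
Serre: "si `s ∈ Gal(K_d/K_nr)`, il existe une unique racine `d`-ième de l'unité `θ_d(s)` telle
que `s(x^{1/d}) = θ_d(s) x^{1/d}`, et l'application `θ_d : Gal(K_d/K_nr) → μ_d` ainsi définie
est un isomorphisme" (`I = Gal(K_s/K_nr) ↠ Gal(K_d/K_nr)`); Prop. 1: `θ : I_t ≃ lim← μ_d`.
[cite: SerreInventiones1972, §1.3 (θ_d isomorphisme) and Prop. 1] -/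
theorem exists_mem_absInertia_smul_eq_mul {d : ℕ} (hd : 0 < d)
    {ϖ : 𝒪[F]} (hϖ : Irreducible ϖ) {z : AlgebraicClosure F}
    (hz : z ^ d = algebraMap 𝒪[F] (AlgebraicClosure F) ϖ) {ζ : AlgebraicClosure F} (hζ : ζ ^ d = 1) :
    ∃ σ ∈ absInertia F, σ • z = ζ * z := by
  set M := maxUnramified F
  haveI : Normal M (AlgebraicClosure F) := Normal.tower_top_of_normal F M (AlgebraicClosure F)
  have hz0 : z ≠ 0 := by
    intro h; rw [h, zero_pow hd.ne'] at hz
    exact (algNorm_pos_iff.mp (algNorm_uniformizer_pos hϖ)) hz.symm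
  have hzi : IsIntegral F z :=
    IsIntegral.of_pow hd (by rw [hz, IsScalarTower.algebraMap_apply 𝒪[F] F (AlgebraicClosure F)]; exact isIntegral_algebraMap)
  have halg : IsAlgebraic M z := (hzi.tower_top (A := M)).isAlgebraic
  -- `ζ z` is a root of the minimal polynomial `X ^ d - ϖ` of `z` over `M`
  have hroot : Polynomial.aeval (ζ * z) (minpoly M z) = 0 := by
    rw [minpoly_maxUnramified_eq hd hϖ hz, map_sub, map_pow, Polynomial.aeval_X, Polynomial.aeval_C,
      mul_pow, hζ, one_mul, hz, sub_eq_zero]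
    rfl
  obtain ⟨σ, hσ⟩ := minpoly.exists_algEquiv_of_root' halg hroot
  -- transport `σ : F̄ ≃ₐ[M] F̄` to `Γ_F`; it fixes `M`, hence lies in `I_F`
  refine ⟨(absoluteGaloisGroup.toAlgEquiv F).symm (σ.restrictScalars F), ?_, ?_⟩
  · rw [mem_absInertia_iff_forall_mem_maxUnramified]
    intro x hx
    rw [absoluteGaloisGroup.smul_def, MulEquiv.apply_symm_apply, AlgEquiv.restrictScalars_apply]
    exact σ.commutes (⟨x, hx⟩ : M)
  · rw [absoluteGaloisGroup.smul_def, MulEquiv.apply_symm_apply, AlgEquiv.restrictScalars_apply]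
    exact hσ

end IsNonarchimedeanLocalField
end Literature.NumberTheory.GaloisRepresentations
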